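import Summits.Schanuel.Schanuel.Theorems.ZilberEacParamCurveLogRootNorm
import Summits.Schanuel.Schanuel.Theorems.ZilberEacFibreCurveGrowthTwo
import HarnessLib

/-!
# Polynomially parametrised base curves, XXVII: the POSITION of the logarithmically corrected
# roots on the ray to second order — `z₀ = (k+1) ω - r_{d-1}/(d · lc(r)) + o(1)`

HONEST FRAMING.  Cell `pub-schanuel` (Zilber's Exponential-Algebraic Closedness, case ladder;
host summit Schanuel), seat 2, gen 20.  Towards the VANISHING-PHASE class of file XXI
(`d = deg g₀ ∣ n = deg g₁`, `Re(lc(g₁)(i/lc(g₀))^{n/d}) = 0`): there the leading term of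
`Re g₁` along the zeros of `Q(t, e^{g₀(t)})` cancels, and the escape of `x₁ = g₁(t)` is decided at
the next order, which requires the position of the zeros `t_k` to `o(1)` — not only their
direction.  This file refines gen 19's root ON the ray (`exists_alRoot_log_dir`, file XV):
* (file XXVI, `exists_alRoot_log_dir_normLog`: the root with `‖L‖ ≤ log((k+1)‖ω‖) + 4`);
* `norm_rayRoot_sub_center_le` — a posteriori, from `r(z₀) = (k+1)^d s·2πi + E` with `‖E‖ ≤ B`
  and `‖ζ‖ ≤ 1/2`: **`‖z₀ - ((k+1) ω + τ)‖ ≤ ‖ω‖ (10 + 4‖β‖) D² / (k+1)`**, where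
  `τ = -r_{d-1}/(d·lc(r))` is the centre of the `d`-th power (`β = r_{d-1}/(lc(r) ω)`,
  `D = B + 3‖β‖ + S₂ + 1`, `S₂` an explicit coefficient sum): dividing
  `T(e^ζ - 1) = E - r_{d-1} z₀^{d-1} - ℓ₂(z₀)` by `T = lc(r) ω^d (k+1)^d` gives
  `e^ζ - 1 = -β e^{ζ(d-1)/d}/(k+1) + O(D/(k+1)²)`, whence `ζ = -β/(k+1) + O(D²/(k+1)²)` and the
  claim.  With `B = B(k) = O(log k)` (the size of `c₀ + μL`) the right side is `O(log² k / k) → 0`.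
Mantova–Masser's question is OPEN in general (PLMS 2024 §1 p. 5); NOT Schanuel's conjecture
(neither used nor implied; EAC ⇏ SC); `EC(3,2)` stays OPEN.
-/

noncomputable section

open Filter Topology Metric Set Complex Polynomial
open Literature.ModelTheory.Zilber

set_option linter.dupNamespace false

namespace Summit.Schanuel.Schanuel.Theorems

/-! ## Part B. The position of the root to second order -/

/-- `‖(k+1 : ℂ)‖ = k + 1`-style cast helper: `((k : ℂ) + 1) = ((k : ℝ) + 1 : ℝ)`. -/
theorem natCast_add_one_eq_ofReal (k : ℕ) : ((k : ℂ) + 1) = (((k : ℝ) + 1 : ℝ) : ℂ) := by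
  push_cast; ring

/-- **The root's position to second order (a posteriori).**  `deg r = d ≥ 2`,
`lc(r) ω^d = 2πi s`, `z₀ = (k+1) ω e^{ζ/d}` with `‖ζ‖ ≤ 1/2` and
`r(z₀) = (k+1)^d s · 2πi + E`, `‖E‖ ≤ B`.  Then, with `β = r_{d-1}/(lc(r) ω)`,
`τ = -r_{d-1}/(d · lc(r))`, `ℓ₂ = r.eraseLead - r_{d-1} X^{d-1}`,
`S₂ = (Σ‖(ℓ₂)ᵢ‖)(3‖ω‖+1)^{d-2}` and `D = B + 3‖β‖ + S₂ + 1`: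
`‖z₀ - ((k+1) ω + τ)‖ ≤ ‖ω‖ (10 + 4‖β‖) D² / (k+1)`. (new) -/
theorem norm_rayRoot_sub_center_le (r : Polynomial ℂ) (hd : 2 ≤ r.natDegree) {ω : ℂ} {s : ℤ}
    (hs : s = 1 ∨ s = -1) (hω : r.leadingCoeff * ω ^ r.natDegree = 2 * Real.pi * I * s)
    (k : ℕ) {ζ : ℂ} (hζ : ‖ζ‖ ≤ 1 / 2) {E : ℂ} {B : ℝ} (hEB : ‖E‖ ≤ B)
    (hE : r.eval (((k : ℂ) + 1) * ω * exp (ζ / r.natDegree)) =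
      (((k + 1) ^ r.natDegree * s : ℤ) : ℂ) * (2 * Real.pi * I) + E) :
    ‖((k : ℂ) + 1) * ω * exp (ζ / r.natDegree) -
        (((k : ℂ) + 1) * ω - r.coeff (r.natDegree - 1) / (r.natDegree * r.leadingCoeff))‖ ≤
      ‖ω‖ * (10 + 4 * ‖r.coeff (r.natDegree - 1) / (r.leadingCoeff * ω)‖) *
        (B + 3 * ‖r.coeff (r.natDegree - 1) / (r.leadingCoeff * ω)‖ +
          coeffNormSum (r.eraseLead - Polynomial.C (r.coeff (r.natDegree - 1)) *
            Polynomial.X ^ (r.natDegree - 1)) * (3 * ‖ω‖ + 1) ^ (r.natDegree - 2) + 1) ^ 2 /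
        ((k : ℝ) + 1) := by
  obtain ⟨n, hn⟩ : ∃ n : ℕ, r.natDegree = n + 2 := ⟨r.natDegree - 2, by omega⟩
  have hdn1 : r.natDegree - 1 = n + 1 := by omega
  have hdn2 : r.natDegree - 2 = n := by omega
  rw [hdn1, hdn2]
  rw [hn] at hE hω ⊢
  -- names
  obtain ⟨a, ha_def⟩ : ∃ a : ℂ, a = r.leadingCoeff := ⟨_, rfl⟩
  obtain ⟨a', ha'_def⟩ : ∃ a' : ℂ, a' = r.coeff (n + 1) := ⟨_, rfl⟩
  rw [← ha_def] at hω ⊢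
  rw [← ha'_def]
  obtain ⟨ℓ₂, hℓ₂_def⟩ : ∃ ℓ₂ : Polynomial ℂ,
      ℓ₂ = r.eraseLead - Polynomial.C a' * Polynomial.X ^ (n + 1) := ⟨_, rfl⟩
  rw [← hℓ₂_def]
  obtain ⟨β, hβ_def⟩ : ∃ β : ℂ, β = a' / (a * ω) := ⟨_, rfl⟩
  rw [← hβ_def]
  obtain ⟨S₂, hS₂_def⟩ : ∃ S₂ : ℝ, S₂ = coeffNormSum ℓ₂ * (3 * ‖ω‖ + 1) ^ n := ⟨_, rfl⟩
  rw [← hS₂_def]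
  obtain ⟨D, hD_def⟩ : ∃ D : ℝ, D = B + 3 * ‖β‖ + S₂ + 1 := ⟨_, rfl⟩
  rw [← hD_def]
  obtain ⟨kk, hkk_def⟩ : ∃ kk : ℝ, kk = (k : ℝ) + 1 := ⟨_, rfl⟩
  rw [← hkk_def]
  obtain ⟨kkC, hkkC_def⟩ : ∃ kkC : ℂ, kkC = (k : ℂ) + 1 := ⟨_, rfl⟩
  rw [← hkkC_def] at hE ⊢
  obtain ⟨q, hq_def⟩ : ∃ q : ℂ, q = exp (ζ / ((n + 2 : ℕ) : ℂ)) := ⟨_, rfl⟩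
  rw [← hq_def] at hE ⊢
  obtain ⟨z₀, hz₀_def⟩ : ∃ z₀ : ℂ, z₀ = kkC * ω * q := ⟨_, rfl⟩
  rw [← hz₀_def] at hE ⊢
  obtain ⟨T, hT_def⟩ : ∃ T : ℂ, T = (((k + 1) ^ (n + 2) * s : ℤ) : ℂ) * (2 * Real.pi * I) :=
    ⟨_, rfl⟩
  rw [← hT_def] at hE
  -- basic facts
  have hπ := Real.pi_pos
  have hk0 : (0 : ℝ) ≤ (k : ℝ) := Nat.cast_nonneg k
  have hkk1 : 1 ≤ kk := by rw [hkk_def]; linarith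
  have hkkpos : 0 < kk := by linarith
  have hkkC : kkC = ((kk : ℝ) : ℂ) := by rw [hkkC_def, hkk_def]; push_cast; ring
  have hkkCnorm : ‖kkC‖ = kk := by rw [hkkC, Complex.norm_real, Real.norm_eq_abs, abs_of_pos hkkpos]
  have hkkC0 : kkC ≠ 0 := norm_pos_iff.1 (by rw [hkkCnorm]; exact hkkpos)
  have hrhs : (2 * Real.pi * I * s : ℂ) ≠ 0 := by
    have hsC : (s : ℂ) ≠ 0 := by rcases hs with rfl | rfl <;> simp
    have hπC : (Real.pi : ℂ) ≠ 0 := Complex.ofReal_ne_zero.mpr hπ.ne'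
    simp [hsC, hπC, Complex.I_ne_zero]
  have ha0 : a ≠ 0 := by
    rintro rfl; rw [zero_mul] at hω; exact hrhs hω.symm
  have hω0 : ω ≠ 0 := by
    rintro rfl; rw [zero_pow (by omega), mul_zero] at hω; exact hrhs hω.symm
  have hωpos : 0 < ‖ω‖ := norm_pos_iff.2 hω0
  have hB0 : 0 ≤ B := (norm_nonneg E).trans hEB
  have hS₂0 : 0 ≤ S₂ := by rw [hS₂_def]; have := coeffNormSum_nonneg ℓ₂; positivity
  have hD1 : 1 ≤ D := by rw [hD_def]; have := norm_nonneg β; linarith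
  have hD0 : 0 ≤ D := by linarith
  have hdC : ((n + 2 : ℕ) : ℂ) ≠ 0 := Nat.cast_ne_zero.mpr (by omega)
  -- `T`
  have hT : a * (kkC * ω) ^ (n + 2) = T := by
    have : a * (kkC * ω) ^ (n + 2) = kkC ^ (n + 2) * (a * ω ^ (n + 2)) := by rw [mul_pow]; ring
    rw [this, hω, hT_def, hkkC_def]; push_cast; ring
  have hTnorm : ‖T‖ = 2 * Real.pi * kk ^ (n + 2) := by
    rw [← hT, norm_mul, norm_pow, norm_mul, hkkCnorm, mul_pow]
    have hsabs : |(s : ℝ)| = 1 := by rcases hs with rfl | rfl <;> simp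
    have haω : ‖a‖ * ‖ω‖ ^ (n + 2) = 2 * Real.pi := by
      rw [← norm_pow, ← norm_mul, hω]
      simp [hsabs, Complex.norm_real, Real.norm_eq_abs, abs_of_pos hπ]
    calc ‖a‖ * (kk ^ (n + 2) * ‖ω‖ ^ (n + 2)) = (‖a‖ * ‖ω‖ ^ (n + 2)) * kk ^ (n + 2) := by ring
      _ = 2 * Real.pi * kk ^ (n + 2) := by rw [haω]
  have hkk2 : kk ^ 2 ≤ kk ^ (n + 2) := pow_le_pow_right₀ hkk1 (by omega)
  have hkksq : kk ≤ kk ^ 2 := by nlinarith only [hkk1]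
  have h2π : (1 : ℝ) ≤ 2 * Real.pi := by linarith only [Real.pi_gt_three]
  have hTge : kk ^ 2 ≤ ‖T‖ := by
    rw [hTnorm]
    calc kk ^ 2 ≤ kk ^ (n + 2) := hkk2
      _ = 1 * kk ^ (n + 2) := (one_mul _).symm
      _ ≤ 2 * Real.pi * kk ^ (n + 2) := mul_le_mul_of_nonneg_right h2π (pow_nonneg hkkpos.le _)
  have hTpos : 0 < ‖T‖ := lt_of_lt_of_le (by positivity) hTge
  have hT0 : T ≠ 0 := norm_pos_iff.mp hTpos
  -- `q`
  have hζ1 : ‖ζ‖ ≤ 1 := hζ.trans (by norm_num)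
  have hζd : ‖ζ / ((n + 2 : ℕ) : ℂ)‖ ≤ ‖ζ‖ := by
    rw [norm_div, Complex.norm_natCast]
    exact div_le_self (norm_nonneg _) (by norm_cast; omega)
  have hqd : q ^ (n + 2) = exp ζ := by
    rw [hq_def, ← Complex.exp_nat_mul, mul_div_cancel₀ _ hdC]
  have hq1 : q ^ (n + 1) = exp (((n + 1 : ℕ) : ℂ) * (ζ / ((n + 2 : ℕ) : ℂ))) := by
    rw [hq_def, ← Complex.exp_nat_mul]
  have hw1 : ‖((n + 1 : ℕ) : ℂ) * (ζ / ((n + 2 : ℕ) : ℂ))‖ ≤ ‖ζ‖ := by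
    rw [norm_mul, norm_div, Complex.norm_natCast, Complex.norm_natCast]
    have h2 : (0 : ℝ) < ((n + 2 : ℕ) : ℝ) := by positivity
    rw [mul_div_assoc', div_le_iff₀ h2]
    have : ((n + 1 : ℕ) : ℝ) ≤ ((n + 2 : ℕ) : ℝ) := by norm_cast; omega
    nlinarith only [this, norm_nonneg ζ]
  have hq1norm : ‖q ^ (n + 1)‖ ≤ 3 := by
    rw [hq1]; exact norm_exp_le_three (hw1.trans hζ1)
  have hq1sub : ‖q ^ (n + 1) - 1‖ ≤ 2 * ‖ζ‖ := by
    rw [hq1]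
    exact (Complex.norm_exp_sub_one_le (hw1.trans hζ1)).trans
      (mul_le_mul_of_nonneg_left hw1 (by norm_num))
  have hqsub2 : ‖q - 1 - ζ / ((n + 2 : ℕ) : ℂ)‖ ≤ ‖ζ‖ ^ 2 := by
    rw [hq_def]
    refine (Complex.norm_exp_sub_one_sub_id_le (hζd.trans hζ1)).trans ?_
    exact pow_le_pow_left₀ (norm_nonneg _) hζd 2
  -- `z₀`
  have hz₀norm : ‖z₀‖ ≤ kk * (3 * ‖ω‖ + 1) := by
    have hqn : ‖q‖ ≤ 3 := by rw [hq_def]; exact norm_exp_le_three (hζd.trans hζ1)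
    rw [hz₀_def, norm_mul, norm_mul, hkkCnorm]
    calc kk * ‖ω‖ * ‖q‖ ≤ kk * ‖ω‖ * 3 := mul_le_mul_of_nonneg_left hqn (by positivity)
      _ ≤ kk * (3 * ‖ω‖ + 1) := by
          linarith only [hkkpos, show kk * (3 * ‖ω‖ + 1) = kk * ‖ω‖ * 3 + kk by ring]
  have hM1 : 1 ≤ kk * (3 * ‖ω‖ + 1) :=
    one_le_mul_of_one_le_of_one_le hkk1 (by linarith only [norm_nonneg ω])
  -- decomposition of `r`
  have hdecomp := eval_eq_lead_add_sublead_add r hn z₀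
  rw [← ha_def, ← ha'_def, ← hℓ₂_def] at hdecomp
  have hℓ₂deg : ℓ₂.natDegree ≤ n := by rw [hℓ₂_def, ha'_def]; exact natDegree_sublead_le r hn
  have hℓ₂norm : ‖ℓ₂.eval z₀‖ ≤ S₂ * kk ^ n := by
    refine (norm_eval_le_of_natDegree_le ℓ₂ hM1 hz₀norm hℓ₂deg).trans (le_of_eq ?_)
    rw [hS₂_def, mul_pow]; ring
  have hlead : a * z₀ ^ (n + 2) = T * exp ζ := by
    rw [hz₀_def, mul_pow, ← mul_assoc, hT, hqd]
  have hsub : a' * z₀ ^ (n + 1) = T * (β * q ^ (n + 1) / kkC) := by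
    rw [← hT, hβ_def, hz₀_def]
    field_simp
    ring
  -- the key identity
  have hsub' : a' * z₀ ^ (n + 1) * kkC = T * β * q ^ (n + 1) := by
    rw [hsub]; field_simp
  have h2 : T * exp ζ * kkC + T * β * q ^ (n + 1) + ℓ₂.eval z₀ * kkC = (T + E) * kkC := by
    have h3 := hE
    rw [hdecomp] at h3
    linear_combination kkC * h3 - kkC * hlead - hsub'
  have hkey : exp ζ - 1 = E / T - β * q ^ (n + 1) / kkC - ℓ₂.eval z₀ / T := by
    have e : exp ζ - 1 - (E / T - β * q ^ (n + 1) / kkC - ℓ₂.eval z₀ / T) =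
        (T * exp ζ * kkC + T * β * q ^ (n + 1) + ℓ₂.eval z₀ * kkC - (T + E) * kkC) / (T * kkC) := by
      field_simp
      ring
    rw [h2, sub_self, zero_div] at e
    exact sub_eq_zero.1 e
  -- the three small terms
  have hE_T : ‖E / T‖ ≤ B / kk ^ 2 := by
    rw [norm_div]
    calc ‖E‖ / ‖T‖ ≤ B / ‖T‖ := div_le_div_of_nonneg_right hEB hTpos.le
      _ ≤ B / kk ^ 2 := div_le_div_of_nonneg_left hB0 (by positivity) hTge
  have hβ_term : ‖β * q ^ (n + 1) / kkC‖ ≤ 3 * ‖β‖ / kk := by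
    rw [norm_div, norm_mul, hkkCnorm]
    refine div_le_div_of_nonneg_right ?_ hkkpos.le
    calc ‖β‖ * ‖q ^ (n + 1)‖ ≤ ‖β‖ * 3 := mul_le_mul_of_nonneg_left hq1norm (norm_nonneg β)
      _ = 3 * ‖β‖ := by ring
  have hℓ₂_T : ‖ℓ₂.eval z₀ / T‖ ≤ S₂ / kk ^ 2 := by
    rw [norm_div, hTnorm, div_le_div_iff₀ (by positivity) (by positivity)]
    have e : kk ^ (n + 2) = kk ^ n * kk ^ 2 := by ring
    rw [e]
    calc ‖ℓ₂.eval z₀‖ * kk ^ 2 ≤ S₂ * kk ^ n * kk ^ 2 :=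
          mul_le_mul_of_nonneg_right hℓ₂norm (by positivity)
      _ = 1 * (S₂ * (kk ^ n * kk ^ 2)) := by ring
      _ ≤ 2 * Real.pi * (S₂ * (kk ^ n * kk ^ 2)) :=
          mul_le_mul_of_nonneg_right h2π (by positivity)
      _ = S₂ * (2 * Real.pi * (kk ^ n * kk ^ 2)) := by ring
  -- crude bound on `ζ`
  have hinv : 1 / kk ^ 2 ≤ 1 / kk := div_le_div_of_nonneg_left zero_le_one hkkpos hkksq
  have hexp1 : ‖exp ζ - 1‖ ≤ D / kk := by
    rw [hkey]
    calc ‖E / T - β * q ^ (n + 1) / kkC - ℓ₂.eval z₀ / T‖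
        ≤ ‖E / T‖ + ‖β * q ^ (n + 1) / kkC‖ + ‖ℓ₂.eval z₀ / T‖ := by
          refine (norm_sub_le _ _).trans (add_le_add ((norm_sub_le _ _).trans le_rfl) le_rfl)
      _ ≤ B / kk ^ 2 + 3 * ‖β‖ / kk + S₂ / kk ^ 2 := add_le_add (add_le_add hE_T hβ_term) hℓ₂_T
      _ ≤ B / kk + 3 * ‖β‖ / kk + S₂ / kk := by
          have h1 : B / kk ^ 2 ≤ B / kk := by
            rw [div_eq_mul_one_div, div_eq_mul_one_div B kk]
            exact mul_le_mul_of_nonneg_left hinv hB0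
          have h3 : S₂ / kk ^ 2 ≤ S₂ / kk := by
            rw [div_eq_mul_one_div, div_eq_mul_one_div S₂ kk]
            exact mul_le_mul_of_nonneg_left hinv hS₂0
          linarith only [h1, h3]
      _ = (B + 3 * ‖β‖ + S₂) / kk := by ring
      _ ≤ D / kk := div_le_div_of_nonneg_right
          (by rw [hD_def]; exact le_add_of_nonneg_right zero_le_one) hkkpos.le
  have hζle : ‖ζ‖ ≤ 2 * D / kk := by
    have h1 : ‖exp ζ - 1 - ζ‖ ≤ ‖ζ‖ ^ 2 := Complex.norm_exp_sub_one_sub_id_le hζ1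
    have h2 : ‖ζ‖ ≤ ‖exp ζ - 1‖ + ‖exp ζ - 1 - ζ‖ := by
      have := norm_sub_le (exp ζ - 1) (exp ζ - 1 - ζ)
      rwa [sub_sub_cancel] at this
    have h3 : ‖ζ‖ ^ 2 ≤ ‖ζ‖ * (1 / 2) := by
      rw [pow_two]; exact mul_le_mul_of_nonneg_left hζ (norm_nonneg _)
    have h4 : ‖ζ‖ ≤ 2 * ‖exp ζ - 1‖ := by linarith only [h1, h2, h3]
    calc ‖ζ‖ ≤ 2 * ‖exp ζ - 1‖ := h4
      _ ≤ 2 * (D / kk) := mul_le_mul_of_nonneg_left hexp1 (by norm_num)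
      _ = 2 * D / kk := by ring
  have hζsq : ‖ζ‖ ^ 2 ≤ 4 * D ^ 2 / kk ^ 2 := by
    have h0 : 0 ≤ ‖ζ‖ := norm_nonneg ζ
    calc ‖ζ‖ ^ 2 ≤ (2 * D / kk) ^ 2 := pow_le_pow_left₀ h0 hζle 2
      _ = 4 * D ^ 2 / kk ^ 2 := by ring
  -- refined bound on `ζ + β/(k+1)`
  have hrefid : ζ + β / kkC =
      -(exp ζ - 1 - ζ) + E / T - β * (q ^ (n + 1) - 1) / kkC - ℓ₂.eval z₀ / T := by
    rw [hkey]; ring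
  have hrefined : ‖ζ + β / kkC‖ ≤ (4 * D ^ 2 + D + 4 * ‖β‖ * D) / kk ^ 2 := by
    rw [hrefid]
    have hb2 : ‖β * (q ^ (n + 1) - 1) / kkC‖ ≤ 4 * ‖β‖ * D / kk ^ 2 := by
      rw [norm_div, norm_mul, hkkCnorm, div_le_div_iff₀ hkkpos (by positivity)]
      have h1 : ‖q ^ (n + 1) - 1‖ ≤ 4 * D / kk := by
        calc ‖q ^ (n + 1) - 1‖ ≤ 2 * ‖ζ‖ := hq1sub
          _ ≤ 2 * (2 * D / kk) := mul_le_mul_of_nonneg_left hζle (by norm_num)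
          _ = 4 * D / kk := by ring
      have h2 : ‖β‖ * ‖q ^ (n + 1) - 1‖ * kk ^ 2 ≤ ‖β‖ * (4 * D / kk) * kk ^ 2 :=
        mul_le_mul_of_nonneg_right (mul_le_mul_of_nonneg_left h1 (norm_nonneg β)) (by positivity)
      have e : ‖β‖ * (4 * D / kk) * kk ^ 2 = 4 * ‖β‖ * D * kk := by
        field_simp
      exact h2.trans e.le
    calc ‖-(exp ζ - 1 - ζ) + E / T - β * (q ^ (n + 1) - 1) / kkC - ℓ₂.eval z₀ / T‖
        ≤ ‖-(exp ζ - 1 - ζ)‖ + ‖E / T‖ + ‖β * (q ^ (n + 1) - 1) / kkC‖ + ‖ℓ₂.eval z₀ / T‖ := by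
          refine (norm_sub_le _ _).trans (add_le_add ?_ le_rfl)
          exact (norm_sub_le _ _).trans (add_le_add (norm_add_le _ _) le_rfl)
      _ ≤ 4 * D ^ 2 / kk ^ 2 + B / kk ^ 2 + 4 * ‖β‖ * D / kk ^ 2 + S₂ / kk ^ 2 := by
          rw [norm_neg]
          exact add_le_add (add_le_add (add_le_add
            ((Complex.norm_exp_sub_one_sub_id_le hζ1).trans hζsq) hE_T) hb2) hℓ₂_T
      _ = (4 * D ^ 2 + (B + S₂) + 4 * ‖β‖ * D) / kk ^ 2 := by ring
      _ ≤ (4 * D ^ 2 + D + 4 * ‖β‖ * D) / kk ^ 2 := by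
          refine div_le_div_of_nonneg_right ?_ (by positivity)
          have : B + S₂ ≤ D := by rw [hD_def]; linarith only [norm_nonneg β]
          linarith only [this]
  -- the position
  have e0 : a' / (((n + 2 : ℕ) : ℂ) * a) = β * ω / ((n + 2 : ℕ) : ℂ) := by
    rw [hβ_def]
    field_simp
  have e1 : kkC * ω / ((n + 2 : ℕ) : ℂ) * (ζ + β / kkC) =
      kkC * ω * ζ / ((n + 2 : ℕ) : ℂ) + β * ω / ((n + 2 : ℕ) : ℂ) := by
    field_simp
  have hposid : z₀ - (kkC * ω - a' / (((n + 2 : ℕ) : ℂ) * a)) =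
      kkC * ω * (q - 1 - ζ / ((n + 2 : ℕ) : ℂ)) + kkC * ω / ((n + 2 : ℕ) : ℂ) * (ζ + β / kkC) := by
    rw [e0, e1, hz₀_def]
    ring
  rw [hposid]
  have hdR : (1 : ℝ) ≤ ((n + 2 : ℕ) : ℝ) := by norm_cast; omega
  have ht1 : ‖kkC * ω * (q - 1 - ζ / ((n + 2 : ℕ) : ℂ))‖ ≤ ‖ω‖ * (4 * D ^ 2) / kk := by
    rw [norm_mul, norm_mul, hkkCnorm, le_div_iff₀ hkkpos]
    have h := hqsub2.trans hζsq
    calc kk * ‖ω‖ * ‖q - 1 - ζ / ((n + 2 : ℕ) : ℂ)‖ * kk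
        = ‖ω‖ * (‖q - 1 - ζ / ((n + 2 : ℕ) : ℂ)‖ * kk ^ 2) := by ring
      _ ≤ ‖ω‖ * (4 * D ^ 2 / kk ^ 2 * kk ^ 2) :=
          mul_le_mul_of_nonneg_left (mul_le_mul_of_nonneg_right h (by positivity)) (norm_nonneg ω)
      _ = ‖ω‖ * (4 * D ^ 2) := by field_simp
  have ht2 : ‖kkC * ω / ((n + 2 : ℕ) : ℂ) * (ζ + β / kkC)‖ ≤
      ‖ω‖ * (4 * D ^ 2 + D + 4 * ‖β‖ * D) / kk := by
    rw [norm_mul, norm_div, norm_mul, hkkCnorm, Complex.norm_natCast]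
    have h1 : kk * ‖ω‖ / ((n + 2 : ℕ) : ℝ) ≤ kk * ‖ω‖ := div_le_self (by positivity) hdR
    calc kk * ‖ω‖ / ((n + 2 : ℕ) : ℝ) * ‖ζ + β / kkC‖
        ≤ kk * ‖ω‖ * ((4 * D ^ 2 + D + 4 * ‖β‖ * D) / kk ^ 2) :=
          mul_le_mul h1 hrefined (norm_nonneg _) (by positivity)
      _ = ‖ω‖ * (4 * D ^ 2 + D + 4 * ‖β‖ * D) / kk := by field_simp
  calc ‖kkC * ω * (q - 1 - ζ / ((n + 2 : ℕ) : ℂ)) + kkC * ω / ((n + 2 : ℕ) : ℂ) * (ζ + β / kkC)‖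
      ≤ ‖ω‖ * (4 * D ^ 2) / kk + ‖ω‖ * (4 * D ^ 2 + D + 4 * ‖β‖ * D) / kk :=
        (norm_add_le _ _).trans (add_le_add ht1 ht2)
    _ = ‖ω‖ * (8 * D ^ 2 + D + 4 * ‖β‖ * D) / kk := by ring
    _ ≤ ‖ω‖ * (10 + 4 * ‖β‖) * D ^ 2 / kk := by
        refine div_le_div_of_nonneg_right ?_ hkkpos.le
        have hDD : D ≤ D ^ 2 := by nlinarith only [hD1]
        have h5 : ‖β‖ * D ≤ ‖β‖ * D ^ 2 := mul_le_mul_of_nonneg_left hDD (norm_nonneg β)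
        have h6 : 8 * D ^ 2 + D + 4 * ‖β‖ * D ≤ (10 + 4 * ‖β‖) * D ^ 2 := by
          linarith only [hDD, h5, sq_nonneg D]
        calc ‖ω‖ * (8 * D ^ 2 + D + 4 * ‖β‖ * D) ≤ ‖ω‖ * ((10 + 4 * ‖β‖) * D ^ 2) :=
              mul_le_mul_of_nonneg_left h6 (norm_nonneg ω)
          _ = ‖ω‖ * (10 + 4 * ‖β‖) * D ^ 2 := by ring

end Summit.Schanuel.Schanuel.Theorems
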